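import Summits.MatrixMultiplication.MatrixMultiplication.Theorems.TetraDiagonalCore
import HarnessLib

/-!
# The single-edge pencil of the tetrahedron tensor: `P_n^{(d)}` (edge `01` deleted, edge `23` of bond `d`)

Support kernel for `stmt-MatrixMultiplication-33477` (`TetraFlat : ω(K₄) ≤ 4`) of route
`TetrahedronCarving` (lineage `decomp-mm-lens-6`, generation 20: barrier-complement carving).

Inside the cubic format of `T(K₄)_n` (`TetrahedronTensorCore`) we restrict the label of edge `01` to
the single value `0` (the edge is DELETED: an EPR pair of dimension `1`) and the label of the opposite
edge `23` to `< d` (bond dimension `d`); the 4-cycle `02, 03, 12, 13` keeps bond `n`. This is the graph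
tensor of the DIAMOND `K₄ - e` with a pencil parameter `d` on the edge opposite to the deleted one:

* `d = n`: the diamond `D_n = T(K₄ - e)_n` (two triangles `023`, `123` glued along the edge `23`, or:
  the triangle `023 ⊗` the cherry `{12, 13}`);
* `d = 1`: the 4-cycle `T(C₄)_n` (iterated matrix multiplication `⟨n,n,n,n⟩`, flat);
* `P_n^{(d)} = χ · Z_n^{(d)}` is a leg-wise restriction of the thin-diagonal tetrahedron of
  `TetraDiagonalCore` (g19), hence of `T(K₄)_n`.

Main results (every field): §1 restriction bounds `R₄(P) ≤ R₄(Z) ≤ R₄(T(K₄))`, monotonicity,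
saturation; §2 grouping floor `R(⟨N², d, N²⟩) ≤ R₄(P_N^{(d)})`; §3 the TRIANGLE-TIMES-CHERRY cover
`R₄(P_n^{(d)}) ≤ R(⟨n, d, n⟩) · n²`. In exponents (`EdgePencilExponent`): `ω(2,ε,2) ≤ ψ(ε) ≤ ω(1,ε,1) + 2`.

References: M. Christandl, P. Vrana, J. Zuiddam, *Asymptotic tensor rank of graph tensors: beyond
matrix multiplication*, comput. complexity 28 (2019) 57–111, arXiv:1609.07476, Ex. 1.1.2 (graph
tensors with non-uniform bond dimensions), Prop. 1.1.16, Prop. 1.1.26 (covers by triangles).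
[ChristandlVranaZuiddam2016]
-/

noncomputable section

set_option linter.dupNamespace false

open scoped BigOperators
open Filter Asymptotics
open Literature.Computability.AlgebraicComplexity
open Summit.MatrixMultiplication.MatrixMultiplication.Theorems.TetrahedronTensor
open Summit.MatrixMultiplication.MatrixMultiplication.Theorems.TetraDiagonal

namespace Summit.MatrixMultiplication.MatrixMultiplication.Theorems.EdgePencil

/-! ## §1 The pencil tensor `P_n^{(d)}` -/

section Tensor

variable (F : Type*) [Field F]

/-- The four leg-wise restriction functions of the pencil: vertex `0` restricts its slot `0` (edge `01`)
to the label `0` (bond `1`), vertex `2` its slot `2` (edge `23`) to `< d`; vertices `1, 3` are tied to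
them by consistency. -/
def pencilLegs (n d : ℕ) : Fin 4 → Fin (n ^ 3) → F :=
  ![thinInd F n 1 0, fun _ => 1, thinInd F n d 2, fun _ => 1]

/-- **The single-edge pencil** `P_n^{(d)}`: the graph tensor of `K₄` with bond `1` on the edge `01`
(deleted), bond `d` on the opposite edge `23` and bond `n` on the 4-cycle `02, 03, 12, 13`, inside the
format of `T(K₄)_n`. For `d = n` it is the diamond `T(K₄ - e)_n`, for `d = 1` the 4-cycle `T(C₄)_n`.
(CVZ19 Ex. 1.1.2, non-uniform bond dimensions). -/
def pencil (n d : ℕ) : (Fin 4 → Fin (n ^ 3)) → F :=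
  fun i => (∏ v, pencilLegs F n d v (i v)) * tetra F n i

/-- The restriction functions cutting `P^{(d)}` out of `Z^{(d)}`: only the slot `0` of vertex `0`. -/
def edgeLegs (n : ℕ) : Fin 4 → Fin (n ^ 3) → F :=
  ![thinInd F n 1 0, fun _ => 1, fun _ => 1, fun _ => 1]

variable {F}

/-- The leg product of `pencilLegs`. -/
theorem prod_pencilLegs {n d : ℕ} (i : Fin 4 → Fin (n ^ 3)) :
    ∏ v, pencilLegs F n d v (i v) = thinInd F n 1 0 (i 0) * thinInd F n d 2 (i 2) := by
  rw [Fin.prod_univ_four]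
  simp [pencilLegs]

/-- The leg product of `edgeLegs`. -/
theorem prod_edgeLegs {n : ℕ} (i : Fin 4 → Fin (n ^ 3)) :
    ∏ v, edgeLegs F n v (i v) = thinInd F n 1 0 (i 0) := by
  rw [Fin.prod_univ_four]
  simp [edgeLegs]

/-- **`P_n^{(d)} = χ₀₁ · Z_n^{(d)}`**: the pencil is the thin-diagonal tetrahedron with the edge `01`
deleted (leg-wise restriction at vertex `0`). -/
theorem pencil_eq_legMul_diagTetra (n d : ℕ) :
    pencil F n d = fun i => (∏ v, edgeLegs F n v (i v)) * diagTetra F n d i := by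
  funext i
  simp only [pencil, diagTetra, prod_pencilLegs, prod_thinLegs, prod_edgeLegs]
  rcases Nat.lt_or_ge d 1 with hd | hd
  · -- `d = 0`: both sides vanish (no label is `< 0` in slot `2`)
    have hd0 : d = 0 := by omega
    subst hd0
    have h2 : thinInd F n 0 2 (i 2) = 0 := by
      unfold thinInd
      rw [if_neg (Nat.not_lt_zero _)]
    rw [h2]
    ring
  · have h0 := thinInd_mul_thinInd_of_le (F := F) hd 0 (i 0)
    calc thinInd F n 1 0 (i 0) * thinInd F n d 2 (i 2) * tetra F n i
        = (thinInd F n 1 0 (i 0) * thinInd F n d 0 (i 0)) * thinInd F n d 2 (i 2) * tetra F n i := by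
          rw [h0]
      _ = thinInd F n 1 0 (i 0) * (thinInd F n d 0 (i 0) * thinInd F n d 2 (i 2) * tetra F n i) := by
          ring

/-- **`R₄(P_n^{(d)}) ≤ R₄(Z_n^{(d)})`** (restriction of the thin-diagonal tetrahedron). [folklore] -/
theorem tensorRankD_pencil_le_diagTetra (n d : ℕ) :
    tensorRankD (pencil F n d) ≤ tensorRankD (diagTetra F n d) := by
  rw [pencil_eq_legMul_diagTetra (F := F) n d]
  exact tensorRankD_legMul_le _ _ (diagTetra_decomposable n d)

/-- **`R₄(P_n^{(d)}) ≤ R₄(T(K₄)_n)`** (restriction of the tetrahedron). [folklore] -/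
theorem tensorRankD_pencil_le_tetra (n d : ℕ) :
    tensorRankD (pencil F n d) ≤ tensorRankD (tetra F n) :=
  (tensorRankD_pencil_le_diagTetra n d).trans (tensorRankD_diagTetra_le_tetra n d)

/-- `P_n^{(d)}` decomposes over rank-one tensors. -/
theorem pencil_decomposable (n d : ℕ) :
    ∃ s : ℕ, ∃ g : Fin s → ((Fin 4 → Fin (n ^ 3)) → F),
      (∀ k, g k ∈ rankOneTensors F (n ^ 3) 4) ∧ ∑ k, g k = pencil F n d :=
  legMul_decomposable (tetra F n) (pencilLegs F n d) (tetra_decomposable n)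

/-- A rank-one decomposition of `P_n^{(d)}` of length exactly `R₄(P_n^{(d)})`. [folklore] -/
theorem exists_rankOne_decomposition_pencil (n d : ℕ) :
    ∃ u : Fin (tensorRankD (pencil F n d)) → Fin 4 → Fin (n ^ 3) → F,
      ∑ k, rankOneTensor (u k) = pencil F n d := by
  classical
  obtain ⟨g, hg, hs⟩ := sComplexity_spec (pencil_decomposable (F := F) n d)
  simp only [rankOneTensors, Set.mem_range] at hg
  choose u hu using hg
  have h : ∑ k, rankOneTensor (u k) = ∑ k, g k := Finset.sum_congr rfl fun k _ => hu k
  exact ⟨u, h.trans hs⟩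

/-- Nested pencil: `P^{(d)} = χ_d · P^{(d')}` for `d ≤ d'`. -/
theorem pencil_eq_legMul_pencil {n d d' : ℕ} (h : d ≤ d') :
    pencil F n d = fun i => (∏ v, thinLegs F n d v (i v)) * pencil F n d' i := by
  funext i
  simp only [pencil, prod_pencilLegs, prod_thinLegs]
  have h2 := thinInd_mul_thinInd_of_le (F := F) h 2 (i 2)
  -- `χ₁ · χ_d = χ₁` on slot `0` when `1 ≤ d`; for `d = 0` everything vanishes through slot `2`
  rcases Nat.lt_or_ge d 1 with hd | hd
  · have hd0 : d = 0 := by omega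
    subst hd0
    have hz : thinInd F n 0 2 (i 2) = 0 := by
      unfold thinInd
      rw [if_neg (Nat.not_lt_zero _)]
    rw [hz]
    ring
  · have h01 := thinInd_mul_thinInd_of_le (F := F) hd 0 (i 0)
    calc thinInd F n 1 0 (i 0) * thinInd F n d 2 (i 2) * tetra F n i
        = (thinInd F n 1 0 (i 0) * thinInd F n d 0 (i 0)) * (thinInd F n d 2 (i 2) *
            thinInd F n d' 2 (i 2)) * tetra F n i := by rw [h01, h2]
      _ = thinInd F n d 0 (i 0) * thinInd F n d 2 (i 2) *
            (thinInd F n 1 0 (i 0) * thinInd F n d' 2 (i 2) * tetra F n i) := by ring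

/-- **Monotone in the bond of the kept edge**: `R₄(P_n^{(d)}) ≤ R₄(P_n^{(d')})` for `d ≤ d'`. [folklore] -/
theorem tensorRankD_pencil_mono {n d d' : ℕ} (h : d ≤ d') :
    tensorRankD (pencil F n d) ≤ tensorRankD (pencil F n d') := by
  rw [pencil_eq_legMul_pencil (F := F) h]
  exact tensorRankD_legMul_le _ _ (pencil_decomposable n d')

/-- **Saturation**: for `d ≥ n` the pencil is the diamond `P_n^{(n)} = T(K₄ - e)_n`. -/
theorem pencil_of_le {n d : ℕ} (h : n ≤ d) : pencil F n d = pencil F n n := by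
  funext i
  simp only [pencil, prod_pencilLegs, thinInd_of_le h, thinInd_of_le le_rfl]

end Tensor

/-! ## §2 Grouping floor: `R(⟨N², d, N²⟩) ≤ R₄(P_N^{(d)})` -/

section Grouping

variable {F : Type*} [Field F]

/-- **The grouped pencil is `⟨N², d, N²⟩`** (`1 ≤ d ≤ N`): at the grouped label triples `dLabels`
(edge `01` frozen to `0` — which is exactly the pencil's deleted edge — and the middle index on the edge
`23`), the pencil takes the value of the matrix multiplication tensor. [folklore] -/
theorem pencil_dLabels {N d : ℕ} [NeZero N] (hd : 0 < d) (hdN : d ≤ N)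
    (a : Fin (N * N) × Fin (N * N)) (b : Fin (N * N) × Fin d) (c : Fin d × Fin (N * N)) :
    pencil F N d (fun v => enc (dLabels hdN a b c v 0) (dLabels hdN a b c v 1)
        (dLabels hdN a b c v 2)) = matMulTensor F (N * N) d (N * N) a b c := by
  rw [← diagTetra_dLabels (F := F) hd hdN a b c, pencil_eq_legMul_diagTetra]
  simp only [prod_edgeLegs]
  have h00 : dLabels hdN a b c 0 0 = 0 := by simp [dLabels, groupLabels]
  have h0 : thinInd F N 1 0 (enc (dLabels hdN a b c 0 0) (dLabels hdN a b c 0 1)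
      (dLabels hdN a b c 0 2)) = 1 := by
    simp only [thinInd, symm_enc, Matrix.cons_val_zero, h00]
    rw [if_pos]
    simp
  rw [h0, one_mul]

/-- **Grouping floor** `R(⟨N², d, N²⟩) ≤ R₄(P_N^{(d)})` (`1 ≤ d ≤ N`): group the endpoints of the deleted
edge. In exponents: `ω(2, ε, 2) ≤ ψ(ε)`, in particular `4 ≤ ψ(ε)` and `2ω ≤ ψ` at the book end. [folklore] -/
theorem tensorRank_matMulTensor_le_tensorRankD_pencil {N d : ℕ} [NeZero N] (hd : 0 < d)
    (hdN : d ≤ N) :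
    tensorRank (matMulTensor F (N * N) d (N * N)) ≤ tensorRankD (pencil F N d) := by
  classical
  obtain ⟨u, hu⟩ := exists_rankOne_decomposition_pencil (F := F) N d
  refine tensorRank_le_of_eq_sum
    (fun k (a : Fin (N * N) × Fin (N * N)) =>
      u k 0 (enc 0 (finProdFinEquiv.symm a.1).1 (finProdFinEquiv.symm a.2).1) *
        u k 1 (enc 0 (finProdFinEquiv.symm a.1).2 (finProdFinEquiv.symm a.2).2))
    (fun k (b : Fin (N * N) × Fin d) =>
      u k 2 (enc (finProdFinEquiv.symm b.1).1 (finProdFinEquiv.symm b.1).2 (Fin.castLE hdN b.2)))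
    (fun k (c : Fin d × Fin (N * N)) =>
      u k 3 (enc (finProdFinEquiv.symm c.2).1 (finProdFinEquiv.symm c.2).2 (Fin.castLE hdN c.1))) ?_
  funext a b c
  have hpt := congrFun hu
    (fun v => enc (dLabels hdN a b c v 0) (dLabels hdN a b c v 1) (dLabels hdN a b c v 2))
  rw [Finset.sum_apply, pencil_dLabels hd hdN] at hpt
  rw [← hpt, Finset.sum_apply, Finset.sum_apply, Finset.sum_apply]
  refine Finset.sum_congr rfl fun k _ => ?_
  rw [rankOneTensor_apply, Fin.prod_univ_four, triad_apply]
  simp only [dLabels, groupLabels, Matrix.cons_val_zero, Matrix.cons_val_one, Matrix.cons_val_two,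
    Matrix.cons_val_three, Matrix.head_cons, Matrix.tail_cons]

end Grouping

/-! ## §3 The triangle-times-cherry cover: `R₄(P_n^{(d)}) ≤ R(⟨n, d, n⟩) · n²` -/

section Cover

variable {F : Type*} [Field F]

/-- The `j`-th label of a leg index (a label triple). -/
def lab {n : ℕ} (x : Fin (n ^ 3)) (j : Fin 3) : Fin n := finFunctionFinEquiv.symm x j

/-- `{0,1}`-indicator of a proposition. -/
def ind (P : Prop) [Decidable P] : F := if P then 1 else 0

/-- Product of indicators. -/
theorem ind_mul_ind (P Q : Prop) [Decidable P] [Decidable Q] :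
    (ind P : F) * ind Q = ind (P ∧ Q) := by
  by_cases hP : P <;> by_cases hQ : Q <;> simp [ind, hP, hQ]

/-- Orthogonality of indicators: `∑_q [a = q][b = q] = [a = b]`. -/
theorem sum_ind_eq_mul_ind_eq {n : ℕ} (a b : Fin n) :
    ∑ q : Fin n, (ind (a = q) : F) * ind (b = q) = ind (a = b) := by
  classical
  have h : ∀ q : Fin n, (ind (a = q) : F) * ind (b = q) = if a = q then ind (b = q) else 0 := by
    intro q
    by_cases haq : a = q <;> simp [ind, haq]
  rw [Finset.sum_congr rfl fun q _ => h q, Finset.sum_ite_eq]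
  simp only [Finset.mem_univ, if_true, ind]
  by_cases hab : a = b
  · subst hab; simp
  · rw [if_neg (Ne.symm hab), if_neg hab]

/-- Extension by zero of a function on `Fin n × Fin d` along the second coordinate to `Fin n`. -/
def extMid {n d : ℕ} (f : Fin n × Fin d → F) (a y : Fin n) : F :=
  if h : (y : ℕ) < d then f (a, ⟨y, h⟩) else 0

/-- Extension by zero of a function on `Fin d × Fin n` along the first coordinate to `Fin n`. -/
def extFst {n d : ℕ} (g : Fin d × Fin n → F) (y b : Fin n) : F :=
  if h : (y : ℕ) < d then g (⟨y, h⟩, b) else 0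

/-- The thin slot-`2` indicator is the indicator of `lab x 2 < d`. -/
theorem thinInd_two_eq {n d : ℕ} (x : Fin (n ^ 3)) :
    thinInd F n d 2 x = ind ((lab x 2 : ℕ) < d) := rfl

/-- The deleted-edge indicator is the indicator of `lab x 0 < 1`. -/
theorem thinInd_zero_eq {n : ℕ} (x : Fin (n ^ 3)) :
    thinInd F n 1 0 x = ind ((lab x 0 : ℕ) < 1) := rfl

/-- **Pointwise value of the pencil.** -/
theorem pencil_apply {n d : ℕ} (i : Fin 4 → Fin (n ^ 3)) :
    pencil F n d i = ind (((lab (i 0) 0 : ℕ) < 1 ∧ (lab (i 2) 2 : ℕ) < d) ∧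
      (lab (i 0) 0 = lab (i 1) 0 ∧ lab (i 0) 1 = lab (i 2) 0 ∧ lab (i 0) 2 = lab (i 3) 0 ∧
        lab (i 1) 1 = lab (i 2) 1 ∧ lab (i 1) 2 = lab (i 3) 1 ∧ lab (i 2) 2 = lab (i 3) 2)) := by
  simp only [pencil, prod_pencilLegs, thinInd_zero_eq, thinInd_two_eq, ind_mul_ind]
  have ht : tetra F n i = ind (lab (i 0) 0 = lab (i 1) 0 ∧ lab (i 0) 1 = lab (i 2) 0 ∧
      lab (i 0) 2 = lab (i 3) 0 ∧ lab (i 1) 1 = lab (i 2) 1 ∧ lab (i 1) 2 = lab (i 3) 1 ∧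
      lab (i 2) 2 = lab (i 3) 2) := by
    simp only [tetra, ind, lab]
    by_cases hc : consistent (fun v => (finFunctionFinEquiv.symm (i v) : Fin 3 → Fin n)) = true
    · rw [if_pos hc, if_pos ((consistent_iff _).1 hc)]
    · rw [if_neg hc, if_neg (fun h => hc ((consistent_iff _).2 h))]
  rw [ht, ind_mul_ind]

/-- **The triangle part of the cover, pointwise**: from `⟨n, d, n⟩ = ∑_k w_k ⊗ u_k ⊗ v_k`,
`∑_k w_k(a) · ũ_k(a', y) · ṽ_k(y', b) = [y < d ∧ a.1 = a' ∧ y = y' ∧ a.2 = b]` (`ũ, ṽ` the extensions by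
zero of `u_k, v_k` in the thin coordinate). -/
theorem sum_triad_ext {n d r : ℕ} {w : Fin r → Fin n × Fin n → F} {u : Fin r → Fin n × Fin d → F}
    {v : Fin r → Fin d × Fin n → F} (hdec : matMulTensor F n d n = ∑ j, triad (w j) (u j) (v j))
    (a : Fin n × Fin n) (a' y y' b : Fin n) :
    ∑ k, w k a * extMid (u k) a' y * extFst (v k) y' b =
      ind ((y : ℕ) < d ∧ (a.1 = a' ∧ y = y' ∧ a.2 = b)) := by
  classical
  by_cases hy : (y : ℕ) < d
  · by_cases hy' : (y' : ℕ) < d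
    · have h := congrFun (congrFun (congrFun hdec a) (a', ⟨y, hy⟩)) (⟨y', hy'⟩, b)
      rw [Finset.sum_apply, Finset.sum_apply, Finset.sum_apply] at h
      simp only [triad_apply, matMulTensor] at h
      simp only [extMid, extFst, dif_pos hy, dif_pos hy']
      rw [← h, ind]
      refine if_congr ?_ rfl rfl
      simp only [Fin.ext_iff]
      tauto
    · have hz : ∀ k, w k a * extMid (u k) a' y * extFst (v k) y' b = 0 := fun k => by
        simp [extFst, dif_neg hy']
      rw [Finset.sum_congr rfl fun k _ => hz k, Finset.sum_const_zero, ind, if_neg]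
      rintro ⟨-, -, hyy, -⟩
      exact hy' (by rw [← hyy]; exact hy)
  · have hz : ∀ k, w k a * extMid (u k) a' y * extFst (v k) y' b = 0 := fun k => by
      simp [extMid, dif_neg hy]
    rw [Finset.sum_congr rfl fun k _ => hz k, Finset.sum_const_zero, ind, if_neg]
    exact fun h => hy h.1

/-- The four legs of the cover summand indexed by `s = (k, p, q)`: `k` a triad index of `⟨n, d, n⟩`
(triangle `023`: bonds `02 : n`, `23 : d`, `03 : n`), `(p, q)` the labels of the cherry `{12, 13}`.
(CVZ19 Prop. 1.1.26 (proof), for the diamond). -/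
def pencilCoverLeg {n d r : ℕ} (w : Fin r → Fin n × Fin n → F) (u : Fin r → Fin n × Fin d → F)
    (v : Fin r → Fin d × Fin n → F) (s : Fin r × Fin n × Fin n) : Fin 4 → Fin (n ^ 3) → F :=
  ![fun x => ind ((lab x 0 : ℕ) < 1) * w s.1 (lab x 1, lab x 2),
    fun x => ind ((lab x 0 : ℕ) < 1) * (ind (lab x 1 = s.2.1) * ind (lab x 2 = s.2.2)),
    fun x => ind (lab x 1 = s.2.1) * extMid (u s.1) (lab x 0) (lab x 2),
    fun x => ind (lab x 1 = s.2.2) * extFst (v s.1) (lab x 2) (lab x 0)]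

/-- **The cover decomposition**: from `⟨n, d, n⟩ = ∑_{k<r} w_k ⊗ u_k ⊗ v_k`,
`P_n^{(d)} = ∑_{(k,p,q)} ⊗_v pencilCoverLeg_{(k,p,q)}(v)` (`r · n²` rank-one terms).
[cite: ChristandlVranaZuiddam2016, Prop. 1.1.26 (proof)] -/
theorem pencil_eq_sum_cover {n d r : ℕ} {w : Fin r → Fin n × Fin n → F}
    {u : Fin r → Fin n × Fin d → F} {v : Fin r → Fin d × Fin n → F}
    (hdec : matMulTensor F n d n = ∑ j, triad (w j) (u j) (v j)) :
    ∑ s : Fin r × Fin n × Fin n, rankOneTensor (pencilCoverLeg w u v s) = pencil F n d := by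
  classical
  funext i
  -- abbreviations at the point `i`
  set χ₀ : F := ind ((lab (i 0) 0 : ℕ) < 1) with hχ₀
  set χ₁ : F := ind ((lab (i 1) 0 : ℕ) < 1) with hχ₁
  set X : Fin r → F := fun k => w k (lab (i 0) 1, lab (i 0) 2) *
    extMid (u k) (lab (i 2) 0) (lab (i 2) 2) * extFst (v k) (lab (i 3) 2) (lab (i 3) 0) with hX
  set Y : Fin n → F := fun p => ind (lab (i 1) 1 = p) * ind (lab (i 2) 1 = p) with hY
  set Z : Fin n → F := fun q => ind (lab (i 1) 2 = q) * ind (lab (i 3) 1 = q) with hZ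
  have hterm : ∀ s : Fin r × Fin n × Fin n, rankOneTensor (pencilCoverLeg w u v s) i =
      χ₀ * χ₁ * X s.1 * Y s.2.1 * Z s.2.2 := by
    rintro ⟨k, p, q⟩
    rw [rankOneTensor_apply, Fin.prod_univ_four]
    simp only [pencilCoverLeg, Matrix.cons_val_zero, Matrix.cons_val_one, Matrix.cons_val_two,
      Matrix.cons_val_three, Matrix.head_cons, Matrix.tail_cons, hX, hY, hZ, hχ₀, hχ₁]
    ring
  have hsumY : ∑ p, Y p = ind (lab (i 1) 1 = lab (i 2) 1) := sum_ind_eq_mul_ind_eq _ _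
  have hsumZ : ∑ q, Z q = ind (lab (i 1) 2 = lab (i 3) 1) := sum_ind_eq_mul_ind_eq _ _
  have hsumX : ∑ k, X k = ind (((lab (i 2) 2 : ℕ) < d) ∧ (lab (i 0) 1 = lab (i 2) 0 ∧
      lab (i 2) 2 = lab (i 3) 2 ∧ lab (i 0) 2 = lab (i 3) 0)) :=
    sum_triad_ext hdec _ _ _ _ _
  calc (∑ s : Fin r × Fin n × Fin n, rankOneTensor (pencilCoverLeg w u v s)) i
      = ∑ s : Fin r × Fin n × Fin n, χ₀ * χ₁ * X s.1 * Y s.2.1 * Z s.2.2 := by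
        rw [Finset.sum_apply]
        exact Finset.sum_congr rfl fun s _ => hterm s
    _ = ∑ k : Fin r, ∑ p : Fin n, ∑ q : Fin n, χ₀ * χ₁ * X k * Y p * Z q := by
        rw [Fintype.sum_prod_type]
        refine Finset.sum_congr rfl fun k _ => ?_
        rw [Fintype.sum_prod_type]
    _ = (χ₀ * χ₁) * (∑ k, X k) * (∑ p, Y p) * (∑ q, Z q) := by
        simp only [Finset.mul_sum, Finset.sum_mul]
        -- both sides are now triple sums; align the summation order `k, p, q` / `q, p, k`
        conv_lhs => rw [Finset.sum_comm]
        conv_rhs => rw [Finset.sum_comm]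
        exact Finset.sum_congr rfl fun p _ => Finset.sum_comm
    _ = pencil F n d i := by
        rw [hsumX, hsumY, hsumZ, hχ₀, hχ₁, pencil_apply, ind_mul_ind, ind_mul_ind, ind_mul_ind,
          ind_mul_ind]
        simp only [ind]
        refine if_congr ?_ rfl rfl
        constructor
        · rintro ⟨⟨⟨⟨h00, h10⟩, h22d, h0120, h2232, h0230⟩, h1121⟩, h1231⟩
          refine ⟨⟨h00, h22d⟩, ?_, h0120, h0230, h1121, h1231, h2232⟩
          exact Fin.ext (by omega)
        · rintro ⟨⟨h00, h22d⟩, h0010, h0120, h0230, h1121, h1231, h2232⟩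
          refine ⟨⟨⟨⟨h00, ?_⟩, h22d, h0120, h2232, h0230⟩, h1121⟩, h1231⟩
          rw [← h0010]; exact h00

/-- **Cover bound** `R₄(P_n^{(d)}) ≤ R(⟨n, d, n⟩) · n²`: the pencil is the rectangular triangle `023`
(bonds `n, d, n`) times the flat cherry `{12, 13}` at vertex `1` (`n²` rank-one terms). At `d = n`:
`R₄(T(K₄ - e)_n) ≤ R(⟨n,n,n⟩) · n²`. [cite: ChristandlVranaZuiddam2016, Prop. 1.1.26] -/
theorem tensorRankD_pencil_le_cover (n d : ℕ) :
    tensorRankD (pencil F n d) ≤ tensorRank (matMulTensor F n d n) * (n * n) := by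
  classical
  obtain ⟨w, u, v, hdec⟩ := exists_triad_decomposition_tensorRank (matMulTensor F n d n)
  have hsum := pencil_eq_sum_cover hdec
  have hcard : Fintype.card (Fin (tensorRank (matMulTensor F n d n)) × Fin n × Fin n) =
      tensorRank (matMulTensor F n d n) * (n * n) := by simp
  rw [← hcard]
  let e := Fintype.equivFin (Fin (tensorRank (matMulTensor F n d n)) × Fin n × Fin n)
  refine tensorRankD_le_of_eq_sum (fun k => pencilCoverLeg w u v (e.symm k)) ?_
  rw [← hsum]
  exact Fintype.sum_equiv e.symm _ _ (fun _ => rfl)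

/-- **The diamond cover** `R₄(D_n) ≤ R(⟨n,n,n⟩) · n²` (`D_n = P_n^{(n)} = T(K₄ - e)_n`): in exponents
`ψ(1) ≤ ω + 2`. [cite: ChristandlVranaZuiddam2016, Prop. 1.1.26] -/
theorem tensorRankD_diamond_le_cover (n : ℕ) :
    tensorRankD (pencil F n n) ≤ tensorRank (matMulTensor F n n n) * (n * n) :=
  tensorRankD_pencil_le_cover n n

end Cover

end Summit.MatrixMultiplication.MatrixMultiplication.Theorems.EdgePencil

end
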